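import Summits.QuantumFields.BalabanUV.T4Continuum.Support.VectorLineTransportFrame
import Summits.QuantumFields.BalabanUV.T4Continuum.Support.VariationalVectorTaxiOneStep

/-!
# T⁴ programme, spine node NE2 (U1a), lane P2 — «V-COL-TAXI», part 5: LEAF V-UB AND THE `hONE` BINDER AT BAŁABAN's TAXI DATA WITH NO GAUGE CONDITION —
# leaf-03-g4's frame-relative V-UB-L (`exists_ubV_nearFrame_ScV`) instantiated with taxi frames, the straight coarsening and the product line transports, and
# part 4's displayed `hUB1` discharged by it: the only smallness left is `κ⁻¹·3(d−1)n(n−1)·a < 1`, a k-UNIFORM condition on the plaquette class constant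

NE2 formalisation swarm `b2b-balaban-t4-ne2-formalise-*`, leaf prover 04 GEN 4 (`prover-b2b-balaban-t4-ne2-formalise-leaf-04-g4-0`); register row «P2-sup» of
`t4/formal/NE2/LEAVES.md`; journal CLAIMS.log «V-UB-F» ∕ YIELD l.14587 (the generic frame-relative V-UB-L is leaf-03-g4's `VectorLineTransportFrame`; the taxi instances
are this lineage's).  Composition BY NAME of `VectorBlockTrialForm.exists_ubV_nearFrame_ScV` (leaf-03-g4) with this unit's parts 1–2 ∕ 4 (`taxiTv`, `coarseTv`,
`taxiTv_mem_unitary`, `inBlock_defect_taxiTv_adjoint_le`, `lineT_sub_frameT_taxi_le`, `blockSpin_lineT_taxi_le_of_ub`).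

THE DATA (one level: fine torus `Tor (fine n M)` over `Tor M`; `H` a finite-dimensional Hilbert space): UNITARY bond operators `R(x,μ)` with operator plaquette defect
`‖R(x,κ)R(x+e_κ,ι) − R(x,ι)R(x+e_ι,κ)‖ ≤ a`; frames `U′ := taxiTv R`; coarse bonds `Rc := coarseTv R`; Bałaban's product line transports `T := lineT (taxiTv R) R`
([Balaban1985AveragingOperations] (125) ∕ [Balaban1985BackgroundPropagators] (3.13) SHAPES; taxi contours OURS).
 * §1 **`exists_ubV_taxi_ScV`**: `κ⁻¹·3(d−1)n(n−1)a < 1` + (GF1′) ⟹ `∀ φ, ∃ W, QvL n M (lineT (taxiTv R) R) W = φ ∧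
   ScV n M R G W ≤ lamV d (n·(d−1)(n−1)a) C_G (n²C₀) ∕ (1 − κ⁻¹·3(d−1)n(n−1)a)²·nsqV M φ` — LEAF V-UB for the road's fixed form at Bałaban's taxi data; binders:
   unitarity, the plaquette defect, (GF1′) and that one smallness (under the class `n²·a ≤ c`: `n·w ≤ (d−1)c`, `κ⁻¹γ ≤ 180(d−1)6^{d−1}·c`, both k-UNIFORM — a small
   FIELD-STRENGTH condition, no condition on the gauge); `hT` = part 4's `lineT_sub_frameT_taxi_le`, `hw` = part 2's `inBlock_defect_taxiTv_adjoint_le`;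
 * §2 **`blockSpin_lineT_taxi_le`**: part 4's `blockSpin_lineT_taxi_le_of_ub` (leaf-01-g6's `blockSpin_QT_le` at taxi data) with `hUB1` DISCHARGED by §1 at the fine level
   `(L, fine n M)` — the `hONE` binder of the vector bracket for the pure curl form and Bałaban's carrier, hypotheses = unitarity, the plaquette defect, (GF0) ∕ (GF1′)
   and `κ_L⁻¹·3(d−1)L(L−1)a < 1` ONLY.
WHAT IS NOT HERE (stated, not hidden): the `G`-halves (V-GF), V-P ∕ V-REG, the nested (multi-level) taxi line transports of the coarse-level V-UB, the END.

HONEST FRAMING (T4-DAG p. 1).  Instantiation only, at MODEL level (unitary bond operators DATA; taxi ∕ straight contours OURS; SHAPES only, no B0, c5); nothing printed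
is a hypothesis; no `def`, no `def … : Prop`, no `sorry`; axioms standard.  NE2 NOT proved on either road; NE3 OPEN; spine PROVED 0∕9 unchanged; rung (B)+1 finite T⁴ —
NOT infinite volume, NOT mass gap, NOT Clay.  HONEST DEPENDENCY (cell, verbatim): continuum YM on T⁴ ⇐ BetaPertH ∧ nine spine estimates (0/9 proved); BetaPertH ⇐
(D1) ∧ (D4) ∧ CAP+tail; G-an2-4 gates asym, D1 and NE2/3/4.
-/

noncomputable section

namespace Summit.QuantumFields.BalabanUV.T4Continuum.VariationalColourTaxiTransport

open Literature.MathematicalPhysics.QuantumFieldTheory.Balaban1983to89.B5Prop11Plancherel (Tor fine unitVec)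
open Literature.MathematicalPhysics.QuantumFieldTheory.Balaban1983to89.B5Block118 (tstep bpt)
open Summit.QuantumFields.BalabanUV.T4Continuum.VariationalTransfer (blockSpin)
open Summit.QuantumFields.BalabanUV.T4Continuum.VariationalColourFederbush (norm_le_one_of_mem_unitary)
open Summit.QuantumFields.BalabanUV.T4Continuum.VariationalVectorFederbush (lineT)
open Summit.QuantumFields.BalabanUV.T4Continuum.VectorBlockTrialForm (nsqV QvL roughV kappaV exists_ubV_nearFrame_ScV)
open Summit.QuantumFields.BalabanUV.T4Continuum.VariationalVectorForm (ScV SfV qWV lamV lamV_nonneg)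
open Summit.QuantumFields.BalabanUV.T4Continuum.VariationalVectorOneStepPhys (rhoV)

variable {d : ℕ} {H : Type*} [NormedAddCommGroup H] [InnerProductSpace ℂ H] [CompleteSpace H] [FiniteDimensional ℂ H]

/-! ## §1 Leaf V-UB at taxi data -/

section UB

variable (n : ℕ) [NeZero n] (M : Fin d → ℕ) [hM : ∀ μ, NeZero (M μ)]

/-- **LEAF V-UB AT BAŁABAN's TAXI DATA, NO GAUGE CONDITION**: unitary bond operators with plaquette defect `a`, `κ⁻¹·3(d−1)n(n−1)a < 1`, (GF1′) ⟹
`∀ φ, ∃ W, QvL n M (lineT (taxiTv R) R) W = φ ∧ ScV n M R G W ≤ lamV d (n·(d−1)(n−1)a) C_G (n²C₀)∕(1 − κ⁻¹·3(d−1)n(n−1)a)²·nsqV M φ` — leaf-03-g4's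
`exists_ubV_nearFrame_ScV` with `hT` = `lineT_sub_frameT_taxi_le`, `hw` = `inBlock_defect_taxiTv_adjoint_le`. [folklore] -/
theorem exists_ubV_taxi_ScV {R : Tor (fine n M) → Fin d → (H →L[ℂ] H)} (hU : ∀ x μ, R x μ ∈ unitary (H →L[ℂ] H)) {a : ℝ} (ha0 : 0 ≤ a)
    (ha : ∀ x κ ι, ‖R x κ * R (x + unitVec (fine n M) κ) ι - R x ι * R (x + unitVec (fine n M) ι) κ‖ ≤ a) (hd : 1 ≤ d)
    (hc : (kappaV d n)⁻¹ * (3 * (((d - 1 : ℕ) : ℝ) * n * ((n - 1 : ℕ) : ℝ) * a)) < 1)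
    {G : (Tor (fine n M) → Fin d → H) → ℝ} {CG C₀ : ℝ} (hCG : 0 ≤ CG) (hC₀ : 0 ≤ C₀)
    (hG : ∀ W, G W ≤ CG * roughV n M R W + C₀ * nsqV (fine n M) W) :
    ∀ φ : Tor M → Fin d → H, ∃ W : Tor (fine n M) → Fin d → H, QvL n M (lineT n M (taxiTv n M R) R) W = φ ∧
      ScV n M R G W ≤ lamV d (n * (((d - 1 : ℕ) : ℝ) * ((n - 1 : ℕ) : ℝ) * a)) CG ((n : ℝ) ^ 2 * C₀)
        / (1 - (kappaV d n)⁻¹ * (3 * (((d - 1 : ℕ) : ℝ) * n * ((n - 1 : ℕ) : ℝ) * a))) ^ 2 * nsqV M φ :=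
  have hR : ∀ x μ, ‖R x μ‖ ≤ 1 := fun x μ => norm_le_one_of_mem_unitary (hU x μ)
  exists_ubV_nearFrame_ScV n M (U' := taxiTv n M R) (Rc := coarseTv n M R) (T := lineT n M (taxiTv n M R) R) (taxiTv_mem_unitary n M hU)
    (lineT_sub_frameT_taxi_le n M hR ha) hc hR (by positivity) (fun y j ν h => inBlock_defect_taxiTv_adjoint_le n M hU ha y j ν h) hd hCG hC₀ hG

end UB

/-! ## §2 The `hONE` binder at taxi data, leaf V-UB discharged -/

section One

variable (n L : ℕ) [NeZero n] [NeZero L] (M : Fin d → ℕ) [hM : ∀ μ, NeZero (M μ)]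

/-- **THE `hONE` BINDER OF THE VECTOR BRACKET AT BAŁABAN's TAXI DATA, NO TRANSPORT BINDER, NO GAUGE CONDITION**: part 4's `blockSpin_lineT_taxi_le_of_ub` with `hUB1`
discharged by §1 at the fine level (`Λ₁ = lamV d (L·(d−1)(L−1)a) C_G (L²C₀)∕(1 − κ_L⁻¹·3(d−1)L(L−1)a)²`). [folklore] -/
theorem blockSpin_lineT_taxi_le {R' : Tor (fine L (fine n M)) → Fin d → (H →L[ℂ] H)} (hU : ∀ x μ, R' x μ ∈ unitary (H →L[ℂ] H)) {a : ℝ} (ha0 : 0 ≤ a)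
    (ha : ∀ x κ ι, ‖R' x κ * R' (x + unitVec (fine L (fine n M)) κ) ι - R' x ι * R' (x + unitVec (fine L (fine n M)) ι) κ‖ ≤ a) (hd : 1 ≤ d)
    (hc : (kappaV d L)⁻¹ * (3 * (((d - 1 : ℕ) : ℝ) * L * ((L - 1 : ℕ) : ℝ) * a)) < 1)
    {G : (Tor (fine n M) → Fin d → H) → ℝ} (hG0 : ∀ W, 0 ≤ G W) {G' : (Tor (fine L (fine n M)) → Fin d → H) → ℝ} (hG0' : ∀ W', 0 ≤ G' W')
    {CG C₀ : ℝ} (hCG : 0 ≤ CG) (hC₀ : 0 ≤ C₀) (hG' : ∀ W', G' W' ≤ CG * roughV L (fine n M) R' W' + C₀ * nsqV (fine L (fine n M)) W')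
    (W : Tor (fine n M) → Fin d → H) :
    blockSpin (QvL L (fine n M) (lineT L (fine n M) (taxiTv L (fine n M) R') R')) (SfV n L M R' (fun _ => 0)) W
      ≤ (Real.sqrt (ScV n M (coarseTv L (fine n M) R') G W + 4 * ((d : ℝ) + 26) * ((L : ℝ) / (n : ℝ) ^ 2) * rhoV n M (coarseTv L (fine n M) R') W)
          + ((n : ℝ) * L * Real.sqrt (d * (50 * ((L : ℝ) * L * a) ^ 2 / L
                + (32 * (1 + (d : ℝ) ^ 2) + 400) * (((d - 1 : ℕ) : ℝ) * ((L - 1 : ℕ) : ℝ) * ((2 * L - 1 : ℕ) : ℝ) * a) ^ 2) / 2)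
              + (n : ℝ) * (3 * (((d - 1 : ℕ) : ℝ) * L * ((L - 1 : ℕ) : ℝ) * a))
                * Real.sqrt (lamV d (L * (((d - 1 : ℕ) : ℝ) * ((L - 1 : ℕ) : ℝ) * a)) CG ((L : ℝ) ^ 2 * C₀)
                    / (1 - (kappaV d L)⁻¹ * (3 * (((d - 1 : ℕ) : ℝ) * L * ((L - 1 : ℕ) : ℝ) * a))) ^ 2 * (4 * (1 + (d : ℝ) ^ 2) + 50)))
            * Real.sqrt (qWV n M W)) ^ 2 :=
  blockSpin_lineT_taxi_le_of_ub n L M hU ha0 ha hG0 hG0' (div_nonneg (lamV_nonneg hCG (by positivity)) (sq_nonneg _))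
    (exists_ubV_taxi_ScV L (fine n M) hU ha0 ha hd hc hCG hC₀ hG') W

end One

end Summit.QuantumFields.BalabanUV.T4Continuum.VariationalColourTaxiTransport

end
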